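import Summits.ValiantsHypothesis.ValiantsHypothesis.Theorems.BarrierLeverChowHitsPartitionMinorsRShiftCalculus
import Summits.ValiantsHypothesis.ValiantsHypothesis.Theorems.BarrierLeverPartitionMinorsHitByVPBiadditiveDoor
import Summits.ValiantsHypothesis.ValiantsHypothesis.Theorems.BarrierLeverPartitionMinorsChowIntegerCertificates

/-!
# Route BarrierLever — item `ChowHitsPartitionMinorsR` (stmt-ValiantsHypothesis-21882):
# THEOREM H (hybrid design), file 1 — the NORMALISED BASE `∏_a (1 + x_a + y_a)(1 − x_a)(1 − y_a) ≡ ∏_a (1 − x_a y_a)`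

Helper file (`--supports stmt-ValiantsHypothesis-21882`; cell valiant-natproofs, rung V4, 𝒟-side support item of route
BarrierLever; prover seat val-np-p5 gen 32; seat memo MEMO-21882-valnp5-g32.md §6 «THEOREM H», kernel step K-H2). Closes NO item.

THEOREM H (memo §6): every injective equal-size lower-set pair `(R, C)` is hit by `h + min(‖R∖C‖, ‖C∖R‖)` affine forms —
the `h` base forms `1 + x_a + y_a` plus one face-private rotated group per defect column. Its proof starts by multiplying the
design by the FREE pure forms `1 − x_a`, `1 − y_a` (`ChowShift.det_pmat_mul_prod_pureX/Y`, p731065), which turns the base into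
`B' = ∏_a φ_a`, `φ_a = (1 + x_a + y_a)(1 − x_a)(1 − y_a) ≡ 1 − x_a y_a` modulo non-square-free monomials. This file provides:

* `phi a` and its square-free (partition) coefficients `coeff_partitionExpo_phi` (`1` at `(∅,∅)`, `−1` at `({a},{a})`, else `0`);
* `coeff_partitionExpo_prod_phi` — the partition coefficients of `∏_{a∈A} φ_a`: `(−1)^{|S|}` at `(S, S)` with `S ⊆ A`, else `0`;
* `coeff_partitionExpo_baseNormal_mul` — **the base convolution**: for any `G`,
  `coeff_{(V,W)} ((∏_a φ_a)·G) = Σ_{T ⊆ V ∩ W} (−1)^{|T|} coeff_{(V∖T, W∖T)} G`;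
* `pureX_eq`, `pureY_eq`, `prod_base_mul_pure` — `∏_a (1 + x_a + y_a) · ∏_a (1 − x_a) · ∏_a (1 − y_a) = ∏_a φ_a`, and
  `det_pmat_base_mul` — **`det pmat ((∏_a (1 + x_a + y_a))·G) = det pmat ((∏_a φ_a)·G)`** on an injective lower-set layout
  (pure forms are free).

WHAT THIS IS NOT: THEOREM H itself is the last file of the chain; nothing here on item 21882's truth, crux 14610 or `VP ≠ VNP`.
-/

set_option linter.dupNamespace false

namespace Summit.ValiantsHypothesis.ValiantsHypothesis.Theorems.BarrierLever.ChowHybrid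

open Finset MvPolynomial
open Summit.ValiantsHypothesis.ValiantsHypothesis.Theorems.BarrierLever.ChowShift
  (pmat det_pmat_mul_prod_pureX det_pmat_mul_prod_pureY)
open Summit.ValiantsHypothesis.ValiantsHypothesis.Theorems.BarrierLever.BiadditiveDoor (coeff_partitionExpo_mul)
open Summit.ValiantsHypothesis.ValiantsHypothesis.Theorems.BarrierLever.ChowFactor (coeff_partitionExpo_one)
open Summit.ValiantsHypothesis.ValiantsHypothesis.Theorems.BarrierLever.CorankRepair (partitionExpo_eq_iff)

noncomputable section

variable {h r : ℕ} {S : Type*} [CommRing S]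

/-! ## 1. The normalised vertex factor `φ_a` -/

/-- The base form of vertex `a`: `1 + x_a + y_a`. -/
def baseForm (a : Fin h) : MvPolynomial (Fin (h + h)) S := 1 + X (Fin.castAdd h a) + X (Fin.natAdd h a)

/-- The normalised vertex factor `φ_a = (1 + x_a + y_a)(1 − x_a)(1 − y_a)`. -/
def phi (a : Fin h) : MvPolynomial (Fin (h + h)) S :=
  baseForm a * (1 - X (Fin.castAdd h a)) * (1 - X (Fin.natAdd h a))

/-- `φ_a = 1 − x_a y_a + (non-square-free terms)`. -/
theorem phi_eq (a : Fin h) :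
    (phi a : MvPolynomial (Fin (h + h)) S) = 1 - X (Fin.castAdd h a) * X (Fin.natAdd h a) +
      X (Fin.castAdd h a) * X (Fin.castAdd h a) * (X (Fin.natAdd h a) - 1) +
      X (Fin.natAdd h a) * X (Fin.natAdd h a) * (X (Fin.castAdd h a) - 1) := by
  unfold phi baseForm
  ring

/-- A monomial containing a square of the variable `v` has zero coefficient at every square-free partition exponent. -/
theorem coeff_partitionExpo_X_mul_X_mul (v : Fin (h + h)) (g : MvPolynomial (Fin (h + h)) S)
    (A B : Finset (Fin h)) :
    coeff (∑ a ∈ A, Finsupp.single (Fin.castAdd h a) 1 + ∑ c ∈ B, Finsupp.single (Fin.natAdd h c) 1)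
      (X v * X v * g) = 0 := by
  classical
  rw [mul_assoc, coeff_X_mul']
  split_ifs with hv
  · rw [coeff_X_mul', if_neg]
    intro hv'
    rw [Finsupp.mem_support_iff, Finsupp.tsub_apply, Finsupp.single_eq_same] at hv'
    apply hv'
    -- the exponent of `v` in a partition exponent is `≤ 1`
    have hle : (∑ a ∈ A, Finsupp.single (Fin.castAdd h a) 1 + ∑ c ∈ B, Finsupp.single (Fin.natAdd h c) 1 :
        Fin (h + h) →₀ ℕ) v ≤ 1 := by
      induction v using Fin.addCases with
      | left a =>
        rw [Summit.ValiantsHypothesis.ValiantsHypothesis.Theorems.BarrierLever.ProductStateSums.partitionExpo_apply_castAdd]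
        split_ifs <;> omega
      | right c =>
        rw [Summit.ValiantsHypothesis.ValiantsHypothesis.Theorems.BarrierLever.ProductStateSums.partitionExpo_apply_natAdd]
        split_ifs <;> omega
    omega
  · rfl

/-- **Square-free coefficients of `φ_a`**: `1` at `(∅, ∅)`, `−1` at `({a}, {a})`, `0` elsewhere. -/
theorem coeff_partitionExpo_phi (a : Fin h) (A B : Finset (Fin h)) :
    coeff (∑ a' ∈ A, Finsupp.single (Fin.castAdd h a') 1 + ∑ c ∈ B, Finsupp.single (Fin.natAdd h c) 1)
      (phi a : MvPolynomial (Fin (h + h)) S) =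
      if A = ∅ ∧ B = ∅ then 1 else if A = {a} ∧ B = {a} then -1 else 0 := by
  classical
  rw [phi_eq, coeff_add, coeff_add, coeff_sub, coeff_partitionExpo_X_mul_X_mul, coeff_partitionExpo_X_mul_X_mul,
    add_zero, add_zero, coeff_partitionExpo_one]
  -- the monomial `x_a y_a`
  have hxy : (X (Fin.castAdd h a) * X (Fin.natAdd h a) : MvPolynomial (Fin (h + h)) S) =
      monomial (∑ a' ∈ ({a} : Finset (Fin h)), Finsupp.single (Fin.castAdd h a') 1 +
        ∑ c ∈ ({a} : Finset (Fin h)), Finsupp.single (Fin.natAdd h c) 1) 1 := by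
    rw [Finset.sum_singleton, Finset.sum_singleton, X, X, monomial_mul, mul_one]
  rw [hxy, coeff_monomial]
  by_cases h0 : A = ∅ ∧ B = ∅
  · obtain ⟨rfl, rfl⟩ := h0
    rw [if_pos ⟨rfl, rfl⟩, if_neg, sub_zero, if_pos ⟨rfl, rfl⟩]
    intro e
    have := ((partitionExpo_eq_iff _ _ _ _).mp e).1
    exact Finset.singleton_ne_empty a this
  · rw [if_neg h0, if_neg h0, zero_sub]
    by_cases h1 : A = {a} ∧ B = {a}
    · obtain ⟨rfl, rfl⟩ := h1
      rw [if_pos rfl, if_pos ⟨rfl, rfl⟩]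
    · rw [if_neg h1, if_neg, neg_zero]
      intro e
      have := (partitionExpo_eq_iff _ _ _ _).mp e
      exact h1 ⟨this.1.symm, this.2.symm⟩

/-! ## 2. Square-free coefficients of `∏_{a ∈ A} φ_a` -/

/-- For `S' ⊆ U`: `U \ S' = ∅ ↔ S' = U`. -/
theorem sdiff_eq_empty_iff_eq {U S' : Finset (Fin h)} (hS' : S' ⊆ U) : U \ S' = ∅ ↔ S' = U := by
  rw [Finset.sdiff_eq_empty_iff_subset]
  exact ⟨fun h' => Finset.Subset.antisymm hS' h', fun h' => h' ▸ Finset.Subset.refl _⟩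

/-- For `S' ⊆ U`: `U \ S' = {a} ↔ a ∈ U ∧ S' = U.erase a`. -/
theorem sdiff_eq_singleton_iff {U S' : Finset (Fin h)} {a : Fin h} (hS' : S' ⊆ U) :
    U \ S' = {a} ↔ a ∈ U ∧ S' = U.erase a := by
  classical
  constructor
  · intro e
    have ha : a ∈ U \ S' := by rw [e]; exact Finset.mem_singleton_self a
    rw [Finset.mem_sdiff] at ha
    refine ⟨ha.1, ?_⟩
    ext x
    rw [Finset.mem_erase]
    constructor
    · intro hx
      refine ⟨fun hxa => ha.2 (hxa ▸ hx), hS' hx⟩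
    · rintro ⟨hxa, hxU⟩
      by_contra hxS
      have : x ∈ U \ S' := Finset.mem_sdiff.mpr ⟨hxU, hxS⟩
      rw [e, Finset.mem_singleton] at this
      exact hxa this
  · rintro ⟨ha, rfl⟩
    ext x
    rw [Finset.mem_sdiff, Finset.mem_erase, Finset.mem_singleton]
    constructor
    · rintro ⟨hxU, hx⟩
      by_contra hxa
      exact hx ⟨hxa, hxU⟩
    · rintro rfl
      exact ⟨ha, fun hh => hh.1 rfl⟩

/-- One convolution step: `coeff_{(U,W)} (F · φ_a) = coeff_{(U,W)} F − [a ∈ U][a ∈ W] · coeff_{(U−a, W−a)} F`. -/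
theorem coeff_partitionExpo_mul_phi (F : MvPolynomial (Fin (h + h)) S) (a : Fin h) (U W : Finset (Fin h)) :
    coeff (∑ a' ∈ U, Finsupp.single (Fin.castAdd h a') 1 + ∑ c ∈ W, Finsupp.single (Fin.natAdd h c) 1) (F * phi a) =
      coeff (∑ a' ∈ U, Finsupp.single (Fin.castAdd h a') 1 + ∑ c ∈ W, Finsupp.single (Fin.natAdd h c) 1) F -
        (if a ∈ U ∧ a ∈ W then coeff (∑ a' ∈ U.erase a, Finsupp.single (Fin.castAdd h a') 1 +
          ∑ c ∈ W.erase a, Finsupp.single (Fin.natAdd h c) 1) F else 0) := by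
  classical
  rw [coeff_partitionExpo_mul]
  -- abbreviation for the coefficients of `F`
  set cF : Finset (Fin h) → Finset (Fin h) → S := fun S' T' =>
    coeff (∑ a' ∈ S', Finsupp.single (Fin.castAdd h a') 1 + ∑ c ∈ T', Finsupp.single (Fin.natAdd h c) 1) F with hcF
  have hsummand : ∀ S' ∈ U.powerset, ∀ T' ∈ W.powerset,
      cF S' T' * coeff (∑ a' ∈ U \ S', Finsupp.single (Fin.castAdd h a') 1 +
          ∑ c ∈ W \ T', Finsupp.single (Fin.natAdd h c) 1) (phi a : MvPolynomial (Fin (h + h)) S) =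
        (if S' = U ∧ T' = W then cF S' T' else 0) - (if S' = U.erase a ∧ T' = W.erase a ∧ a ∈ U ∧ a ∈ W then cF S' T' else 0) := by
    intro S' hS' T' hT'
    rw [Finset.mem_powerset] at hS' hT'
    rw [coeff_partitionExpo_phi]
    have e1 : (U \ S' = ∅ ∧ W \ T' = ∅) ↔ (S' = U ∧ T' = W) := by
      rw [sdiff_eq_empty_iff_eq hS', sdiff_eq_empty_iff_eq hT']
    have e2 : (U \ S' = {a} ∧ W \ T' = {a}) ↔ (S' = U.erase a ∧ T' = W.erase a ∧ a ∈ U ∧ a ∈ W) := by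
      rw [sdiff_eq_singleton_iff hS', sdiff_eq_singleton_iff hT']
      tauto
    by_cases h1 : U \ S' = ∅ ∧ W \ T' = ∅
    · have h2 : ¬ (U \ S' = {a} ∧ W \ T' = {a}) := fun hh => by
        rw [h1.1] at hh; exact Finset.singleton_ne_empty a hh.1.symm
      rw [if_pos h1, if_pos (e1.mp h1), if_neg (fun hh => h2 (e2.mpr hh)), mul_one, sub_zero]
    · rw [if_neg h1, if_neg (fun hh => h1 (e1.mpr hh))]
      by_cases h2 : U \ S' = {a} ∧ W \ T' = {a}
      · rw [if_pos h2, if_pos (e2.mp h2), mul_neg, mul_one, zero_sub]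
      · rw [if_neg h2, if_neg (fun hh => h2 (e2.mpr hh)), mul_zero, sub_zero]
  rw [Finset.sum_congr rfl fun S' hS' => Finset.sum_congr rfl fun T' hT' => hsummand S' hS' T' hT']
  simp only [Finset.sum_sub_distrib]
  congr 1
  · rw [Finset.sum_eq_single_of_mem U (Finset.mem_powerset.mpr (Finset.Subset.refl U))
      (fun S' _ hne => Finset.sum_eq_zero fun T' _ => if_neg (fun hh => hne hh.1)),
      Finset.sum_eq_single_of_mem W (Finset.mem_powerset.mpr (Finset.Subset.refl W))
      (fun T' _ hne => if_neg (fun hh => hne hh.2)), if_pos ⟨rfl, rfl⟩]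
  · by_cases haUW : a ∈ U ∧ a ∈ W
    · rw [if_pos haUW,
        Finset.sum_eq_single_of_mem (U.erase a) (Finset.mem_powerset.mpr (Finset.erase_subset a U))
          (fun S' _ hne => Finset.sum_eq_zero fun T' _ => if_neg (fun hh => hne hh.1)),
        Finset.sum_eq_single_of_mem (W.erase a) (Finset.mem_powerset.mpr (Finset.erase_subset a W))
          (fun T' _ hne => if_neg (fun hh => hne hh.2.1)), if_pos ⟨rfl, rfl, haUW.1, haUW.2⟩]
    · rw [if_neg haUW]
      exact Finset.sum_eq_zero fun S' _ => Finset.sum_eq_zero fun T' _ => if_neg (fun hh => haUW ⟨hh.2.2.1, hh.2.2.2⟩)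

/-- **Square-free coefficients of `∏_{a ∈ A} φ_a`**: `(−1)^{|S|}` at `(S, S)` with `S ⊆ A`, `0` elsewhere. -/
theorem coeff_partitionExpo_prod_phi (A : Finset (Fin h)) (U W : Finset (Fin h)) :
    coeff (∑ a' ∈ U, Finsupp.single (Fin.castAdd h a') 1 + ∑ c ∈ W, Finsupp.single (Fin.natAdd h c) 1)
      (∏ a ∈ A, (phi a : MvPolynomial (Fin (h + h)) S)) = if U = W ∧ U ⊆ A then (-1) ^ U.card else 0 := by
  classical
  induction A using Finset.induction_on generalizing U W with
  | empty =>
    rw [Finset.prod_empty, coeff_partitionExpo_one]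
    by_cases h0 : U = ∅ ∧ W = ∅
    · obtain ⟨rfl, rfl⟩ := h0
      rw [if_pos ⟨rfl, rfl⟩, if_pos ⟨rfl, Finset.Subset.refl _⟩, Finset.card_empty, pow_zero]
    · rw [if_neg h0, if_neg]
      rintro ⟨rfl, hU⟩
      exact h0 ⟨Finset.subset_empty.mp hU, Finset.subset_empty.mp hU⟩
  | insert a A ha ih =>
    rw [Finset.prod_insert ha, mul_comm, coeff_partitionExpo_mul_phi, ih, ih]
    by_cases haU : a ∈ U
    · -- `a ∈ U`: the first term vanishes (`U ⊄ A`), the second carries the value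
      rw [if_neg (show ¬ (U = W ∧ U ⊆ A) from fun hh => ha (hh.2 haU))]
      by_cases haW : a ∈ W
      · rw [if_pos ⟨haU, haW⟩]
        by_cases hUW : U = W ∧ U ⊆ insert a A
        · obtain ⟨rfl, hU⟩ := hUW
          rw [if_pos ⟨rfl, fun x hx => Finset.mem_of_mem_insert_of_ne (hU (Finset.mem_of_mem_erase hx))
              (Finset.ne_of_mem_erase hx)⟩, if_pos ⟨rfl, hU⟩,
            Finset.card_erase_of_mem haU, zero_sub]
          have hpos : 0 < U.card := Finset.card_pos.mpr ⟨a, haU⟩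
          obtain ⟨n, hn⟩ : ∃ n, U.card = n + 1 := ⟨U.card - 1, by omega⟩
          rw [hn, Nat.add_sub_cancel, pow_succ]
          ring
        · rw [if_neg hUW, if_neg, sub_zero]
          rintro ⟨hE, hsub⟩
          apply hUW
          refine ⟨?_, ?_⟩
          · rw [← Finset.insert_erase haU, ← Finset.insert_erase haW, hE]
          · intro x hx
            by_cases hxa : x = a
            · rw [hxa]; exact Finset.mem_insert_self a A
            · exact Finset.mem_insert_of_mem (hsub (Finset.mem_erase.mpr ⟨hxa, hx⟩))
      · rw [if_neg (show ¬ (a ∈ U ∧ a ∈ W) from fun hh => haW hh.2), sub_zero, if_neg]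
        rintro ⟨rfl, -⟩
        exact haW haU
    · -- `a ∉ U`
      rw [if_neg (show ¬ (a ∈ U ∧ a ∈ W) from fun hh => haU hh.1), sub_zero]
      by_cases hUW : U = W ∧ U ⊆ A
      · rw [if_pos hUW, if_pos ⟨hUW.1, hUW.2.trans (Finset.subset_insert a A)⟩]
      · rw [if_neg hUW, if_neg]
        rintro ⟨hE, hsub⟩
        exact hUW ⟨hE, fun x hx => Finset.mem_of_mem_insert_of_ne (hsub hx) (fun hxa => haU (hxa ▸ hx))⟩

/-! ## 3. The base convolution -/

/-- **BASE CONVOLUTION.** For any `G`: `coeff_{(V,W)} ((∏_a φ_a)·G) = Σ_{T ⊆ V ∩ W} (−1)^{|T|} coeff_{(V∖T, W∖T)} G`. -/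
theorem coeff_partitionExpo_baseNormal_mul (G : MvPolynomial (Fin (h + h)) S) (V W : Finset (Fin h)) :
    coeff (∑ a' ∈ V, Finsupp.single (Fin.castAdd h a') 1 + ∑ c ∈ W, Finsupp.single (Fin.natAdd h c) 1)
      ((∏ a, (phi a : MvPolynomial (Fin (h + h)) S)) * G) =
      ∑ T ∈ (V ∩ W).powerset, (-1) ^ T.card * coeff (∑ a' ∈ V \ T, Finsupp.single (Fin.castAdd h a') 1 +
        ∑ c ∈ W \ T, Finsupp.single (Fin.natAdd h c) 1) G := by
  classical
  rw [coeff_partitionExpo_mul]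
  simp_rw [coeff_partitionExpo_prod_phi]
  -- inner sum over `T'`: only `T' = S'` survives
  have hinner : ∀ S' ∈ V.powerset,
      (∑ T' ∈ W.powerset, (if S' = T' ∧ S' ⊆ Finset.univ then ((-1 : S) ^ S'.card) else 0) *
        coeff (∑ a' ∈ V \ S', Finsupp.single (Fin.castAdd h a') 1 + ∑ c ∈ W \ T', Finsupp.single (Fin.natAdd h c) 1) G) =
      if S' ⊆ W then (-1) ^ S'.card * coeff (∑ a' ∈ V \ S', Finsupp.single (Fin.castAdd h a') 1 +
        ∑ c ∈ W \ S', Finsupp.single (Fin.natAdd h c) 1) G else 0 := by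
    intro S' _
    by_cases hSW : S' ⊆ W
    · rw [if_pos hSW, Finset.sum_eq_single_of_mem S' (Finset.mem_powerset.mpr hSW)
        (fun T' _ hne => by rw [if_neg (fun hh => hne hh.1.symm), zero_mul]),
        if_pos ⟨rfl, Finset.subset_univ _⟩]
    · rw [if_neg hSW]
      exact Finset.sum_eq_zero fun T' hT' => by
        rw [if_neg, zero_mul]
        rintro ⟨rfl, -⟩
        exact hSW (Finset.mem_powerset.mp hT')
  rw [Finset.sum_congr rfl hinner, ← Finset.sum_filter]
  refine Finset.sum_congr ?_ fun _ _ => rfl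
  ext T
  rw [Finset.mem_filter, Finset.mem_powerset, Finset.mem_powerset, Finset.subset_inter_iff]

/-! ## 4. The base of the hybrid design and the free pure factors -/

/-- `1 + Σ_{a'} (−[a' = k]) x_{a'} = 1 − x_k`. -/
theorem pureX_eq (k : Fin h) :
    (C 1 + ∑ a', C (if a' = k then (-1 : S) else 0) * X (Fin.castAdd h a') : MvPolynomial (Fin (h + h)) S) =
      1 - X (Fin.castAdd h k) := by
  classical
  rw [map_one, Finset.sum_eq_single k (fun a' _ hne => by rw [if_neg hne, map_zero, zero_mul])
    (fun hk => absurd (Finset.mem_univ k) hk), if_pos rfl, map_neg, map_one]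
  ring

/-- `1 + Σ_c (−[c = k]) y_c = 1 − y_k`. -/
theorem pureY_eq (k : Fin h) :
    (C 1 + ∑ c, C (if c = k then (-1 : S) else 0) * X (Fin.natAdd h c) : MvPolynomial (Fin (h + h)) S) =
      1 - X (Fin.natAdd h k) := by
  classical
  rw [map_one, Finset.sum_eq_single k (fun c _ hne => by rw [if_neg hne, map_zero, zero_mul])
    (fun hk => absurd (Finset.mem_univ k) hk), if_pos rfl, map_neg, map_one]
  ring

/-- `∏_a (1 + x_a + y_a) · ∏_a (1 − x_a) · ∏_a (1 − y_a) = ∏_a φ_a`. -/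
theorem prod_base_mul_pure (G : MvPolynomial (Fin (h + h)) S) :
    (∏ a, (baseForm a : MvPolynomial (Fin (h + h)) S)) * G *
        (∏ k : Fin h, (C 1 + ∑ a', C (if a' = k then (-1 : S) else 0) * X (Fin.castAdd h a'))) *
        (∏ k : Fin h, (C 1 + ∑ c, C (if c = k then (-1 : S) else 0) * X (Fin.natAdd h c))) =
      (∏ a, (phi a : MvPolynomial (Fin (h + h)) S)) * G := by
  simp_rw [pureX_eq, pureY_eq]
  unfold phi
  rw [Finset.prod_mul_distrib, Finset.prod_mul_distrib]
  ring

/-- **PURE FORMS ARE FREE, applied to the base:** on an injective lower-set layout,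
`det pmat ((∏_a (1 + x_a + y_a)) · G) = det pmat ((∏_a φ_a) · G)`. -/
theorem det_pmat_base_mul (u w : Fin r → Finset (Fin h)) (hu : Function.Injective u) (hw : Function.Injective w)
    (hlu : IsLowerSet (Set.range u)) (hlw : IsLowerSet (Set.range w)) (G : MvPolynomial (Fin (h + h)) S) :
    (pmat u w ((∏ a, (baseForm a : MvPolynomial (Fin (h + h)) S)) * G)).det =
      (pmat u w ((∏ a, (phi a : MvPolynomial (Fin (h + h)) S)) * G)).det := by
  rw [← prod_base_mul_pure G, det_pmat_mul_prod_pureY u w hu hw hlu hlw, det_pmat_mul_prod_pureX u w hu hw hlu hlw]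

end

end Summit.ValiantsHypothesis.ValiantsHypothesis.Theorems.BarrierLever.ChowHybrid
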